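import Mathlib
import Literature.Analysis.FluidPDE.Tao2016AveragedNS.RenormalisedCascadeWaves
import Literature.Analysis.FluidPDE.Tao2016AveragedNS.BoundedEternalSolutions
import Summits.NavierStokesRegularity.NavierStokesRegularity.Theorems.TaoLadderRungTwoBreakNoSurvivingEternalViscBddOneWakeDyadicAncientApriori
import Summits.NavierStokesRegularity.NavierStokesRegularity.Theorems.TaoLadderRungTwoBreakNoSurvivingEternalViscBddOneWakeDyadicCriticalSquaring
import Summits.NavierStokesRegularity.NavierStokesRegularity.Theorems.TaoLadderRungTwoBreakNoSurvivingEternalViscBddOneWakeDyadicClassical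
import Summits.NavierStokesRegularity.NavierStokesRegularity.Theorems.TaoLadderRungTwoBreakNoSurvivingEternalViscBddOneWakeEquivalence

/-!
# Crux `TaoLadderRungTwoBreak.NoSurvivingEternalViscBddOne` (stmt-NavierStokesRegularity-20419), stub (ρ0), DYADIC MEMBER in
# classical form: STERILISATION above a sub-critical shell, and the survivor's PER-SHELL critical amplitude floor `c_n ≥ Λ⁻¹`

MODEL lattice ODEs only (Tao 2016 §1.2/§4, critical variables of §6.4); nothing here is a statement about the Navier–Stokes
equations; no stub, crux, rung or summit is proved (`--supports stmt-NavierStokesRegularity-20419`).  Sequel to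
`…WakeDyadicCriticalSquaring` (squaring step `c_{n+1} ≤ Λc_n²`, terminal ratio `v_{n+1} ≤ 2Λc_ne^{M/Λ}v_n`) on the positive
type-I classical form of (ρ0)|dyadic (tree `dyadic_noSurviving_iff_classicalPos`); `c_n = sup_{t<0}(-t)V_n(t)` (`= sup_σ W_n`).

* `weightedWake_tendsto_zero_of_subcritical` — **STERILISATION**: if SOME shell `n₀ ∈ ℤ` has `Λ c_{n₀} < 1`, the terminal
  ratios `v_{n+1}/v_n ≤ 2e^{M/Λ}(Λc)^{2^{n-n₀}}` are eventually `≤ 1`, so the a=1-weighted terminal wake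
  `physWeight(1)^n v_n² = (1+ε₀)^{-4n}v_n²` tends to `0` — the conclusion of the classical form of (ρ0)|dyadic holds for that
  solution.
* `crit_floor_of_not_wakeDecay`, `typeI_const_ge_of_not_wakeDecay` — contrapositive, **THE SURVIVOR'S PER-SHELL FLOOR**: a
  solution whose weighted wake does NOT tend to zero (under the tree's dictionary `dyadic_survivingFwd_iff_wakeFloor`: the
  critical-variable form of an (S₁)-SURVIVING admissible inviscid eternal solution of `dyadicTable`) has `c_n ≥ Λ⁻¹` on EVERY
  shell `n ∈ ℤ` (so its type-I constant is `≥ Λ⁻¹`) — eight times the level `q₀ = 1/(4Λ(C_A+1)) = 1/(8Λ)` at which the tree's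
  `…QuietPast.survivingFwd_loud_everywhere` lights every shell, by a different (dyadic, sign-definite) mechanism.

* `dyadic_survivor_shell_floor` — BY NAME on the tree's objects: an admissible inviscid eternal solution `W` of `dyadicTable`
  (`IsEternal ε₀ dyadicTable W`) that is forward (S₁)-surviving (`EternalSurvivingFwd 1 ε₀ W`) has `sup_σ (W_n(σ))₀ ≥ Λ⁻¹` on EVERY
  shell `n ∈ ℤ` (dictionary: tree `dyadic_crit_*`, `dyadic_classical_hyp_nonneg`, `dyadic_survivingFwd_iff_wakeFloor`).

* `dyadic_survivor_uniformBound_ge` (appended) — hence the uniform bound of a survivor: `sup_{n,σ}‖W_n(σ)‖ ≥ Λ⁻¹`.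

READING for ⟨20419⟩/(ρ0) (census of this hand): the W1-dyadic wall is untouched — survivors live at `c_n ≥ Λ⁻¹` on every shell
(and at `sup_n c_n ≳ 1/(5ε₀)` on the DSS stratum, tree `dss_amplitude_floor`); recorded here: the critical amplitude propagates
upward by SQUARING, so a proof of W1-dyadic may assume `Λc_n ≥ 1` shell by shell, and a refutation must keep every shell at that
level.  HONEST LABEL: elementary; (ρ0), ⟨20419⟩, its children and every NS statement remain OPEN; rung 0.
-/

noncomputable section

namespace Summit.NavierStokesRegularity.NavierStokesRegularity.Theorems.NoSurvivingEternalViscBddOne.DyadicCriticalFloor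

open Filter Topology Set MeasureTheory intervalIntegral
open Literature.Analysis.FluidPDE Literature.Analysis.FluidPDE.TaoCascade
open Summit.NavierStokesRegularity.NavierStokesRegularity.Theorems.NoSurvivingEternalViscBddOne.DyadicAncient
open Summit.NavierStokesRegularity.NavierStokesRegularity.Theorems.NoSurvivingEternalViscBddOne.DyadicCriticalSquaring
open Summit.NavierStokesRegularity.NavierStokesRegularity.Theorems.NoSurvivingEternalViscBddOne.WakeCriterion
open Summit.NavierStokesRegularity.NavierStokesRegularity.Theorems.WakeRatchetDyadic (uniformBound_dyadic)

variable {ε₀ : ℝ} {V : ℤ → ℝ → ℝ}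

/-! ## Sterilisation above a sub-critical shell, and the survivor's per-shell floor -/

/-- **STERILISATION.**  If SOME shell `n₀ ∈ ℤ` of a non-negative type-I ancient admissible solution has critical amplitude
`c` with `Λc < 1` (`(-t)V_{n₀}(t) ≤ c` for all `t < 0`), then the a=1-weighted terminal wake tends to zero:
`physWeight(1)^n v_n² = (1+ε₀)^{-4n} v_n² → 0` — the terminal ratios `v_{n+1}/v_n ≤ 2e^{M/Λ}(Λc)^{2^{n-n₀}}` are eventually
`≤ 1`, and the weight `(1+ε₀)^{-4} < 1` does the rest.  (The conclusion of the classical form of (ρ0)|dyadic, for that solution.)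
[cite: Tao2016AveragedNS, §1.2, §4 Thm. 4.2 (statement shape), §6.4; elementary] -/
theorem weightedWake_tendsto_zero_of_subcritical (hε : 0 < ε₀)
    (hV : ∀ (n : ℤ) (t : ℝ), t < 0 →
      HasDerivAt (V n) (bigLam ε₀ * V (n - 1) t ^ 2 - (bigLam ε₀)⁻¹ * (V n t * V (n + 1) t)) t)
    (hpos : ∀ (n : ℤ) (t : ℝ), t < 0 → 0 ≤ V n t)
    (hI : ∃ C : ℝ, ∀ (n : ℤ) (t : ℝ), t < 0 → V n t ≤ C / (-t))
    {M : ℝ} (hact : ∀ n : ℤ, IntegrableOn (fun t => |V n t|) (Iio 0) ∧ ∫ t in Iio 0, |V n t| ≤ M)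
    {v : ℤ → ℝ} (hv : ∀ n : ℤ, Tendsto (V n) (𝓝[<] 0) (𝓝 (v n)))
    {n₀ : ℤ} {c : ℝ} (hc : ∀ t : ℝ, t < 0 → (-t) * V n₀ t ≤ c) (hsub : bigLam ε₀ * c < 1) :
    Tendsto (fun n : ℕ => physWeight 1 ε₀ ^ n * v n ^ 2) atTop (𝓝 0) := by
  have hΛ : 0 < bigLam ε₀ := bigLam_pos (by linarith)
  have hc0 : 0 ≤ c := by
    have h := hc (-1) (by norm_num)
    have h0 : 0 ≤ V n₀ (-1) := hpos n₀ (-1) (by norm_num)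
    nlinarith
  have hx0 : 0 ≤ bigLam ε₀ * c := by positivity
  -- Step 1: a sub-critical shell with NON-NEGATIVE index `m`
  obtain ⟨m, hm⟩ : ∃ m : ℕ, ∀ t : ℝ, t < 0 → (-t) * V (m : ℤ) t ≤ c := by
    rcases le_or_gt 0 n₀ with h0 | h0
    · refine ⟨n₀.toNat, ?_⟩
      rw [Int.toNat_of_nonneg h0]
      exact hc
    · refine ⟨0, fun t ht => ?_⟩
      have hj : n₀ + (((-n₀).toNat : ℕ) : ℤ) = ((0 : ℕ) : ℤ) := by
        rw [Int.toNat_of_nonneg (by linarith)]; push_cast; ring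
      have h := crit_iterate_le hε hV hpos hI n₀ hc (-n₀).toNat t ht
      rw [hj] at h
      refine h.trans ?_
      have hp : (bigLam ε₀ * c) ^ (2 ^ (-n₀).toNat) ≤ bigLam ε₀ * c :=
        pow_le_of_le_one hx0 hsub.le (Nat.two_pow_pos _).ne'
      calc (bigLam ε₀)⁻¹ * (bigLam ε₀ * c) ^ (2 ^ (-n₀).toNat)
          ≤ (bigLam ε₀)⁻¹ * (bigLam ε₀ * c) := mul_le_mul_of_nonneg_left hp (inv_nonneg.2 hΛ.le)
        _ = c := by rw [inv_mul_cancel_left₀ hΛ.ne']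
  -- Step 2: the terminal ratios above `m`
  set a : ℕ → ℝ := fun j => v ((m : ℤ) + (j : ℕ)) with ha
  have ha0 : ∀ j, 0 ≤ a j := fun j => terminal_nonneg hpos hv _
  have hratio : ∀ j : ℕ, a (j + 1) ≤
      2 * Real.exp (M / bigLam ε₀) * (bigLam ε₀ * c) ^ (2 ^ j) * a j := by
    intro j
    have hcj := crit_iterate_le hε hV hpos hI (m : ℤ) hm j
    have h := terminal_succ_le_crit hε hV hpos hI hact hv ((m : ℤ) + (j : ℕ)) hcj
    have e1 : (m : ℤ) + (j : ℕ) + 1 = (m : ℤ) + ((j + 1 : ℕ) : ℤ) := by push_cast; ring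
    rw [e1] at h
    calc a (j + 1) = v ((m : ℤ) + ((j + 1 : ℕ) : ℤ)) := rfl
      _ ≤ 2 * bigLam ε₀ * ((bigLam ε₀)⁻¹ * (bigLam ε₀ * c) ^ (2 ^ j)) *
            (Real.exp (M / bigLam ε₀) * v ((m : ℤ) + (j : ℕ))) := h
      _ = 2 * (bigLam ε₀ * ((bigLam ε₀)⁻¹ * (bigLam ε₀ * c) ^ (2 ^ j))) *
            (Real.exp (M / bigLam ε₀) * a j) := by simp only [ha]; ring
      _ = 2 * (bigLam ε₀ * c) ^ (2 ^ j) * (Real.exp (M / bigLam ε₀) * a j) := by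
          rw [mul_inv_cancel_left₀ hΛ.ne']
      _ = 2 * Real.exp (M / bigLam ε₀) * (bigLam ε₀ * c) ^ (2 ^ j) * a j := by ring
  -- Step 3: the ratio factor is eventually `≤ 1`
  have hgeo : Tendsto (fun j : ℕ => 2 * Real.exp (M / bigLam ε₀) * (bigLam ε₀ * c) ^ j) atTop (𝓝 0) := by
    simpa using (tendsto_pow_atTop_nhds_zero_of_lt_one hx0 hsub).const_mul (2 * Real.exp (M / bigLam ε₀))
  obtain ⟨J, hJ⟩ : ∃ J : ℕ, ∀ j, J ≤ j → 2 * Real.exp (M / bigLam ε₀) * (bigLam ε₀ * c) ^ j ≤ 1 := by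
    have hev := hgeo.eventually (eventually_lt_nhds zero_lt_one)
    obtain ⟨J, hJ⟩ := eventually_atTop.1 hev
    exact ⟨J, fun j hj => (hJ j hj).le⟩
  have hfac : ∀ j, J ≤ j → 2 * Real.exp (M / bigLam ε₀) * (bigLam ε₀ * c) ^ (2 ^ j) ≤ 1 := by
    intro j hj
    have hp : (bigLam ε₀ * c) ^ (2 ^ j) ≤ (bigLam ε₀ * c) ^ j :=
      pow_le_pow_of_le_one hx0 hsub.le (Nat.lt_two_pow_self).le
    have h2 : 0 ≤ 2 * Real.exp (M / bigLam ε₀) := by positivity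
    exact (mul_le_mul_of_nonneg_left hp h2).trans (hJ j hj)
  -- Step 4: `a` is non-increasing beyond `J`, hence bounded by `a J`
  have hanti : ∀ j, J ≤ j → a j ≤ a J := by
    intro j hj
    refine Nat.le_induction le_rfl (fun k hk ih => ?_) j hj
    have h1 := hratio k
    have h2 : 2 * Real.exp (M / bigLam ε₀) * (bigLam ε₀ * c) ^ (2 ^ k) * a k ≤ 1 * a k :=
      mul_le_mul_of_nonneg_right (hfac k hk) (ha0 k)
    linarith
  -- Step 5: the weight `(1+ε₀)^{-4} < 1` finishes
  have hw : physWeight 1 ε₀ = ((1 + ε₀) ^ 4)⁻¹ := by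
    unfold physWeight
    rw [Real.rpow_one]
    field_simp
  have hw0 : 0 ≤ physWeight 1 ε₀ := by rw [hw]; positivity
  have hw1 : physWeight 1 ε₀ < 1 := by
    rw [hw]
    exact inv_lt_one_of_one_lt₀ (one_lt_pow₀ (by linarith) (by norm_num))
  have hlim : Tendsto (fun n : ℕ => a J ^ 2 * physWeight 1 ε₀ ^ n) atTop (𝓝 0) := by
    simpa using (tendsto_pow_atTop_nhds_zero_of_lt_one hw0 hw1).const_mul (a J ^ 2)
  refine squeeze_zero' (Eventually.of_forall fun n => by positivity) ?_ hlim
  refine eventually_atTop.2 ⟨m + J, fun n hn => ?_⟩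
  have hidx : ((n : ℕ) : ℤ) = (m : ℤ) + ((n - m : ℕ) : ℤ) := by
    have : m ≤ n := le_trans (Nat.le_add_right m J) hn
    push_cast [Nat.cast_sub this]; ring
  have hvn : v n = a (n - m) := by simp only [ha]; rw [← hidx]
  have hle : v n ≤ a J := by rw [hvn]; exact hanti (n - m) (by omega)
  have hvn0 : 0 ≤ v n := by rw [hvn]; exact ha0 _
  have hsq : v n ^ 2 ≤ a J ^ 2 := pow_le_pow_left₀ hvn0 hle 2
  calc physWeight 1 ε₀ ^ n * v n ^ 2 ≤ physWeight 1 ε₀ ^ n * a J ^ 2 :=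
        mul_le_mul_of_nonneg_left hsq (pow_nonneg hw0 n)
    _ = a J ^ 2 * physWeight 1 ε₀ ^ n := mul_comm _ _

/-- **THE SURVIVOR'S PER-SHELL CRITICAL AMPLITUDE FLOOR.**  If the a=1-weighted terminal wake of a non-negative type-I ancient
admissible solution does NOT tend to zero (by the tree's dictionary `dyadic_noSurviving_iff_classicalPos` /
`dyadic_survivingFwd_iff_wakeFloor`: the solution is the critical-variable form of an (S₁)-SURVIVING admissible inviscid
eternal solution of the dyadic member), then EVERY shell `n ∈ ℤ` has critical amplitude at least `Λ⁻¹`: any `c` with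
`(-t)V_n(t) ≤ c` for all `t < 0` satisfies `c ≥ Λ⁻¹` (i.e. `sup_σ W_n(σ) ≥ Λ⁻¹` on every shell).
[cite: Tao2016AveragedNS, §1.2, §4 Thm. 4.2 (statement shape), §6.4; elementary] -/
theorem crit_floor_of_not_wakeDecay (hε : 0 < ε₀)
    (hV : ∀ (n : ℤ) (t : ℝ), t < 0 →
      HasDerivAt (V n) (bigLam ε₀ * V (n - 1) t ^ 2 - (bigLam ε₀)⁻¹ * (V n t * V (n + 1) t)) t)
    (hpos : ∀ (n : ℤ) (t : ℝ), t < 0 → 0 ≤ V n t)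
    (hI : ∃ C : ℝ, ∀ (n : ℤ) (t : ℝ), t < 0 → V n t ≤ C / (-t))
    {M : ℝ} (hact : ∀ n : ℤ, IntegrableOn (fun t => |V n t|) (Iio 0) ∧ ∫ t in Iio 0, |V n t| ≤ M)
    {v : ℤ → ℝ} (hv : ∀ n : ℤ, Tendsto (V n) (𝓝[<] 0) (𝓝 (v n)))
    (hS : ¬ Tendsto (fun n : ℕ => physWeight 1 ε₀ ^ n * v n ^ 2) atTop (𝓝 0))
    (n : ℤ) {c : ℝ} (hc : ∀ t : ℝ, t < 0 → (-t) * V n t ≤ c) :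
    (bigLam ε₀)⁻¹ ≤ c := by
  have hΛ : 0 < bigLam ε₀ := bigLam_pos (by linarith)
  by_contra h
  have hsub : bigLam ε₀ * c < 1 := by
    have h' : c < (bigLam ε₀)⁻¹ := not_le.1 h
    calc bigLam ε₀ * c < bigLam ε₀ * (bigLam ε₀)⁻¹ := mul_lt_mul_of_pos_left h' hΛ
      _ = 1 := mul_inv_cancel₀ hΛ.ne'
  exact hS (weightedWake_tendsto_zero_of_subcritical hε hV hpos hI hact hv hc hsub)

/-- **The type-I constant of a survivor is at least `Λ⁻¹`** (the floor read on the uniform constant `C` of the classical form: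
`V_n ≤ C/(-t)` on every shell forces `C ≥ Λ⁻¹` unless the weighted wake decays).
[cite: Tao2016AveragedNS, §1.2, §4 Thm. 4.2 (statement shape), §6.4; elementary] -/
theorem typeI_const_ge_of_not_wakeDecay (hε : 0 < ε₀)
    (hV : ∀ (n : ℤ) (t : ℝ), t < 0 →
      HasDerivAt (V n) (bigLam ε₀ * V (n - 1) t ^ 2 - (bigLam ε₀)⁻¹ * (V n t * V (n + 1) t)) t)
    (hpos : ∀ (n : ℤ) (t : ℝ), t < 0 → 0 ≤ V n t)
    {C : ℝ} (hC : ∀ (n : ℤ) (t : ℝ), t < 0 → V n t ≤ C / (-t))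
    {M : ℝ} (hact : ∀ n : ℤ, IntegrableOn (fun t => |V n t|) (Iio 0) ∧ ∫ t in Iio 0, |V n t| ≤ M)
    {v : ℤ → ℝ} (hv : ∀ n : ℤ, Tendsto (V n) (𝓝[<] 0) (𝓝 (v n)))
    (hS : ¬ Tendsto (fun n : ℕ => physWeight 1 ε₀ ^ n * v n ^ 2) atTop (𝓝 0)) :
    (bigLam ε₀)⁻¹ ≤ C := by
  refine crit_floor_of_not_wakeDecay hε hV hpos ⟨C, hC⟩ hact hv hS 0 fun t ht => ?_
  have hnt : 0 < -t := by linarith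
  have h := hC 0 t ht
  rw [le_div_iff₀ hnt] at h
  linarith


/-! ## By name on the dyadic member of the table class -/

/-- **THE SURVIVOR'S PER-SHELL FLOOR, BY NAME.**  Let `W` be an admissible INVISCID eternal solution of the dyadic member
`dyadicTable` at scale ratio `1+ε₀` (`ε₀ > 0`) that is forward (S₁)-surviving.  Then on EVERY shell `n ∈ ℤ` the renormalised
amplitude reaches the critical level: every `c` with `(W_n(σ))₀ ≤ c` for all log-times `σ` satisfies `c ≥ Λ⁻¹ = (1+ε₀)^{-5/2}`
(critical variables `V_n(t) = (-t)⁻¹(W_n(-log(-t)))₀`, tree dictionary, then `crit_floor_of_not_wakeDecay`; survival is a wake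
floor by the tree's `dyadic_survivingFwd_iff_wakeFloor`).  The objects (ρ0)|dyadic must exclude are `≥ Λ⁻¹` on every shell.
[cite: Tao2016AveragedNS, §1.2, §4 Thm. 4.2 (statement shape), §6.4; this file + tree dictionary] -/
theorem dyadic_survivor_shell_floor (hε : 0 < ε₀) {W : ℤ → ℝ → Em 4} (hW : IsEternal ε₀ dyadicTable W)
    (hS : EternalSurvivingFwd 1 ε₀ W) (n : ℤ) {c : ℝ} (hc : ∀ σ : ℝ, W n σ 0 ≤ c) : (bigLam ε₀)⁻¹ ≤ c := by
  have hW' : IsEternalVisc ε₀ 0 dyadicTable W := hW.isEternalVisc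
  have hU : UniformBound W := uniformBound_dyadic hε hW
  obtain ⟨r, hr⟩ := exists_terminalProfile_fun hW'
  obtain ⟨hpos, C, hC⟩ := dyadic_classical_hyp_nonneg hε hW
  obtain ⟨M, hact⟩ := dyadic_crit_action hε hW
  -- survival ⟹ the weighted terminal wake does not tend to zero
  have hnot : ¬ Tendsto (fun k : ℕ => physWeight 1 ε₀ ^ k * (r k 0) ^ 2) atTop (𝓝 0) := by
    intro hlim
    have hlim' : Tendsto (fun k : ℕ => physWeight 1 ε₀ ^ k * ‖r k‖ ^ 2) atTop (𝓝 0) := by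
      have heq : (fun k : ℕ => physWeight 1 ε₀ ^ k * ‖r k‖ ^ 2)
          = fun k : ℕ => physWeight 1 ε₀ ^ k * (r k 0) ^ 2 := by
        funext k
        rw [dyadic_terminal_norm_sq hε hW hr]
      rw [heq]
      exact hlim
    exact not_wakeFloor_of_tendsto_zero hlim' ((dyadic_survivingFwd_iff_wakeFloor hε hW hU hr).1 hS)
  refine crit_floor_of_not_wakeDecay (V := fun k t => (-t)⁻¹ * W k (-Real.log (-t)) 0) (v := fun k => r k 0) hε
    (fun k t ht => dyadic_crit_hasDerivAt hW k ht) hpos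
    ⟨C, fun k t ht => (le_abs_self _).trans (hC k t ht)⟩ hact
    (fun k => dyadic_crit_tendsto hr k) hnot n fun t ht => ?_
  have hnt : (-t) ≠ 0 := by
    have : 0 < -t := by linarith
    exact this.ne'
  show (-t) * ((-t)⁻¹ * W n (-Real.log (-t)) 0) ≤ c
  rw [mul_inv_cancel_left₀ hnt]
  exact hc _


/-! ## Appended: the uniform bound of a survivor (by name) -/

/-- **THE UNIFORM BOUND OF A SURVIVOR IS AT LEAST `Λ⁻¹`.**  An admissible inviscid eternal solution of `dyadicTable` at scale
ratio `1+ε₀` that is forward (S₁)-surviving has `sup_{n,σ} ‖W_n(σ)‖ ≥ Λ⁻¹ = (1+ε₀)^{-5/2}`: every constant `B` with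
`‖W_n(σ)‖ ≤ B` for all `n, σ` satisfies `B ≥ Λ⁻¹` (read `dyadic_survivor_shell_floor` on any one shell).  On the dyadic member
this sharpens, for (S₁)-survivors, the tree's table-uniform amplitude quantum `sup‖W‖ ≥ 1/K` (`…SmallAmplitudeRung`); on the DSS
stratum the tree's `dss_amplitude_floor` (`≈ 1/(5ε₀)`) is far stronger.
[cite: Tao2016AveragedNS, §1.2, §4 Thm. 4.2 (statement shape), §6.4; this file] -/
theorem dyadic_survivor_uniformBound_ge (hε : 0 < ε₀) {W : ℤ → ℝ → Em 4} (hW : IsEternal ε₀ dyadicTable W)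
    (hS : EternalSurvivingFwd 1 ε₀ W) {B : ℝ} (hB : ∀ (n : ℤ) (σ : ℝ), ‖W n σ‖ ≤ B) : (bigLam ε₀)⁻¹ ≤ B := by
  refine dyadic_survivor_shell_floor hε hW hS 0 fun σ => ?_
  have h1 : |W 0 σ 0| ≤ ‖W 0 σ‖ := by
    have h := EuclideanSpace.norm_eq (W 0 σ)
    calc |W 0 σ 0| = Real.sqrt (|W 0 σ 0| ^ 2) := by rw [Real.sqrt_sq (abs_nonneg _)]
      _ = Real.sqrt (‖W 0 σ 0‖ ^ 2) := by rw [Real.norm_eq_abs]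
      _ ≤ Real.sqrt (∑ i, ‖W 0 σ i‖ ^ 2) := by
          refine Real.sqrt_le_sqrt ?_
          exact Finset.single_le_sum (f := fun i => ‖W 0 σ i‖ ^ 2) (fun i _ => by positivity)
            (Finset.mem_univ (0 : Fin 4))
      _ = ‖W 0 σ‖ := h.symm
  exact ((le_abs_self _).trans h1).trans (hB 0 σ)

end Summit.NavierStokesRegularity.NavierStokesRegularity.Theorems.NoSurvivingEternalViscBddOne.DyadicCriticalFloor

end
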